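import Literature.Topology.FourManifolds.CodimTwoLinkingHomomorphism
import HarnessLib

/-!
# The linking homomorphism `π₁(Sⁿ⁺² ∖ M) → ℤ` of a framed codimension-two submanifold with
# connected core: value `k` on the `k`-fold meridian

Topic `Literature/Topology/FourManifolds`; fact seat
`provefact-Literature.Topology.FourManifolds.isOrientedBordant_of_isEmpty_of_signature_eq_zero`
(Kirby, *The Topology of 4-Manifolds* (1989), Cor. IX.2 via VIII Thm 1(A) and VIII Thm 3).  Sequel
of `CodimTwoLinkingHomomorphism.lean`, which treats a *simply connected* core; here the core `M`
is only assumed **connected** (and compact, `n ≥ 1`), as Kirby's VIII Thm 3 requires for the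
manifold `M₃ ⊂ ℝ⁶` of the proof of VIII Thm 1(A) (p. 46), which after the 1-handles of `W₂` is not
simply connected.  Everything here is **proved**; no named fact is introduced.

* `FramedTubularEmbedding.exists_linkingHom_meridianPow` — **there is a homomorphism
  `φ : π₁(Sⁿ⁺² ∖ M, p₀) → ℤ` with `φ [μᵏ] = k` for every `k ∈ ℤ`**, `μᵏ` the loop
  `t ↦ tube (x₀, e^{2πikt})` winding `k` times around the core (Kirby 1989, proof of VIII Thm. 3:
  the class `α ∈ H¹(Q − N; ℤ)` "dual to the meridian").

## The argument

As in the simply connected case, the Mayer–Vietoris sequence of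
`Sⁿ⁺² = U ∪ X` (`U` the open tube, `X = Sⁿ⁺² ∖ M`, `U ∩ X = P` the punctured tube) gives, for
`n ≥ 1`, an isomorphism `Φ = (i_U, -i_X) : H₁(P; ℤ) ≅ H₁(U; ℤ) ⊕ H₁(X; ℤ)`
(`isIso_mayerVietoris_phi_one`) — now `H₁(U) ≅ H₁(M)` need not vanish.  The loops `μᵏ` lie in
`P` and bound discs in `U` (the normal discs), so `i_U h(μᵏ) = 0` and
`Φ h(μᵏ) = (0, -i_X h(μᵏ))`; hence `φ = (w ∘ arg_* ∘ Φ⁻¹ ∘ (0, ·))⁻¹ ∘ h_X`, with `h` the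
Hurewicz maps and `w : H₁(ℝ/2πℤ; ℤ) ≅ π₁(ℝ/2πℤ) ≅ ℤ` the winding functional
(`exists_windingHom_addCircle_eq`), takes on `[μᵏ]` the value `w (h(arg ∘ μᵏ))`, the degree of
the linear loop `t ↦ 2πkt` of `ℝ/2πℤ`, which is `k` (`fundamentalGroupAddCircleEquiv_linLoop`,
Hatcher Thm. 1.7: the lift of `t ↦ 2πkt` is the segment from `0` to `2πk`).

## References

* R. C. Kirby, *The Topology of 4-Manifolds*, LNM 1374 (1989), Ch. VIII, proof of Thm. 3
  (p. 45). [Kirby1989]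
* A. Hatcher, *Algebraic Topology* (2002), Thm. 1.7, §2.2 (Mayer–Vietoris, p. 149), Thm. 2A.1.
  [HatcherAT2002]
-/

open scoped Manifold ContDiff Topology
open Function Set Filter CategoryTheory CategoryTheory.Limits
open Literature.AlgebraicTopology.SingularHomology Literature.AlgebraicTopology.FundamentalGroup

noncomputable section

namespace Literature.Topology.FourManifolds

/-- Local notation: `𝔼 n` is the model Euclidean space `EuclideanSpace ℝ (Fin n)`. -/
local notation "𝔼 " n:arg => EuclideanSpace ℝ (Fin n)

/-- Local notation: `𝕊 n` is the unit sphere in `EuclideanSpace ℝ (Fin (n + 1))`. -/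
local notation "𝕊 " n:arg => (Metric.sphere (0 : EuclideanSpace ℝ (Fin (n + 1))) 1)

/-- Local notation for the homotopy class of a path (Mathlib's `Path.Homotopic.Quotient.mk`). -/
local notation "⟦" p "⟧ₚ" => Path.Homotopic.Quotient.mk p

-- `Fact (finrank ℝ ℝᵐ⁺¹ = m + 1)`, under which Mathlib charts the round spheres on `ℝᵐ`.
attribute [local instance] fact_finrank_euclideanSpace_succ

/-! ### The degree of the linear loop `t ↦ a + tkp` of `ℝ/pℤ` is `k` -/

section Circle

variable {p : ℝ}

/-- **The linear loop** `t ↦ a + t·k·p` of `ℝ/pℤ`, winding `k` times (`k = 1`: the tree's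
`addCircleLoop`). [cite: HatcherAT2002, Thm. 1.7 (p. 29)] -/
def linLoop (p : ℝ) (a : AddCircle p) (k : ℤ) : Path a a where
  toFun t := a + ((((t : ℝ) * (k * p)) : ℝ) : AddCircle p)
  continuous_toFun := by fun_prop
  source' := by simp
  target' := by
    have h : (((k * p : ℝ)) : AddCircle p) = 0 := by
      rw [AddCircle.coe_eq_zero_iff]
      exact ⟨k, by simp [zsmul_eq_mul]⟩
    simp [h]

/-- Pointwise formula for `linLoop`. [folklore] -/
theorem linLoop_apply (a : AddCircle p) (k : ℤ) (t : unitInterval) :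
    linLoop p a k t = a + ((((t : ℝ) * (k * p)) : ℝ) : AddCircle p) := rfl

/-- The segment `t ↦ e + t·k·p` in `ℝ` from `e` to `e + kp`: the lift of the linear loop starting
at `e`. [cite: HatcherAT2002, Thm. 1.7 (proof, p. 30)] -/
def liftSegmentK (p e : ℝ) (k : ℤ) : Path e (e + k * p) where
  toFun t := e + (t : ℝ) * (k * p)
  continuous_toFun := by fun_prop
  source' := by simp
  target' := by simp

/-- **Monodromy of the linear loop**: along `t ↦ a + tkp` the covering `ℝ → ℝ/pℤ` transports a
lift `e` of `a` to `e + kp`. [cite: HatcherAT2002, Thm. 1.7 (proof, p. 30)] -/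
theorem monodromy_linLoop (a : AddCircle p) (e : ((↑) : ℝ → AddCircle p) ⁻¹' {a}) (k : ℤ) :
    ((AddCircle.isCoveringMap_coe p).monodromy (Path.Homotopic.Quotient.mk (linLoop p a k)) e
      : ℝ) = e.1 + k * p := by
  have hx : ((e.1 : ℝ) : AddCircle p) = a := by
    have h2 := e.2
    rwa [Set.mem_preimage, Set.mem_singleton_iff] at h2
  have hkp : (((k * p : ℝ)) : AddCircle p) = 0 := by
    rw [AddCircle.coe_eq_zero_iff]
    exact ⟨k, by simp [zsmul_eq_mul]⟩
  have hend : ((e.1 + k * p : ℝ) : AddCircle p) ∈ ({a} : Set (AddCircle p)) := by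
    rw [Set.mem_singleton_iff, AddCircle.coe_add, hkp, add_zero]
    exact hx
  have key : (AddCircle.isCoveringMap_coe p).monodromy
      (Path.Homotopic.Quotient.mk (linLoop p a k)) e = ⟨e.1 + k * p, hend⟩ := by
    refine (AddCircle.isCoveringMap_coe p).monodromy_eq_of_map_eq
      (Γ := Path.Homotopic.Quotient.mk (liftSegmentK p e.1 k)) ?_
    rw [← Path.Homotopic.Quotient.mk_map, ← Path.Homotopic.Quotient.mk_cast]
    congr 1
    ext t
    change (((e.1 + (t : ℝ) * (k * p) : ℝ) : AddCircle p)) =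
      a + ((((t : ℝ) * (k * p)) : ℝ) : AddCircle p)
    rw [AddCircle.coe_add, hx]
  rw [key]

/-- Under Mathlib's `fundamentalGroupToMulOpposite` for the covering `ℝ → ℝ/pℤ` the class of the
linear loop is the deck transformation `+kp`. [cite: HatcherAT2002, Thm. 1.7 (p. 29)] -/
theorem fundamentalGroupToMulOpposite_linLoop (a : AddCircle p)
    (e : ((↑) : ℝ → AddCircle p) ⁻¹' {a}) (k : ℤ) :
    (AddCircle.isAddQuotientCoveringMap_coe p).fundamentalGroupToMulOpposite e
        (_root_.FundamentalGroup.fromPath (Path.Homotopic.Quotient.mk (linLoop p a k))) =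
      MulOpposite.op (Multiplicative.ofAdd ⟨k * p, by
        simpa only [zsmul_eq_mul] using (AddSubgroup.zmultiples p).zsmul_mem (AddSubgroup.mem_zmultiples p) k⟩) := by
  rw [IsAddQuotientCoveringMap.fundamentalGroupToMulOpposite_apply_eq_Iff]
  change _ = ((AddCircle.isCoveringMap_coe p).monodromy
    (Path.Homotopic.Quotient.mk (linLoop p a k)) e : ℝ)
  rw [monodromy_linLoop]
  simp [MulOpposite.unop_op, ofAdd_smul, AddSubgroup.vadd_def, add_comm]

/-- **The degree of the linear loop is `k`**: `π₁(ℝ/pℤ, a) ≅ ℤ` (the tree's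
`fundamentalGroupAddCircleEquiv`, normalised by the winding loop) sends `[t ↦ a + tkp]` to `k`.
[cite: HatcherAT2002, Thm. 1.7 (p. 29)] -/
theorem fundamentalGroupAddCircleEquiv_linLoop (hp : p ≠ 0) (a : AddCircle p) (k : ℤ) :
    fundamentalGroupAddCircleEquiv hp a
        (_root_.FundamentalGroup.fromPath (Path.Homotopic.Quotient.mk (linLoop p a k))) =
      Multiplicative.ofAdd k := by
  simp only [fundamentalGroupAddCircleEquiv, MulEquiv.trans_apply,
    IsAddQuotientCoveringMap.fundamentalGroupEquiv, IsQuotientCoveringMap.fundamentalGroupEquiv,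
    MulEquiv.ofBijective_apply]
  change (AddEquiv.toMultiplicative (intEquivZMultiples p hp).symm)
    ((MulOpposite.opMulEquiv (M := Multiplicative (AddSubgroup.zmultiples p))).symm
      ((AddCircle.isAddQuotientCoveringMap_coe p).fundamentalGroupToMulOpposite (addCircleLift a)
        (_root_.FundamentalGroup.fromPath (Path.Homotopic.Quotient.mk (linLoop p a k))))) = _
  rw [fundamentalGroupToMulOpposite_linLoop]
  have hk : (intEquivZMultiples p hp).symm ⟨k * p, by
      simpa only [zsmul_eq_mul] using (AddSubgroup.zmultiples p).zsmul_mem (AddSubgroup.mem_zmultiples p) k⟩ = k := by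
    rw [AddEquiv.symm_apply_eq]
    ext
    rw [intEquivZMultiples_apply_coe]
  simp [hk]

/-- **The winding functional on `H₁(ℝ/pℤ; ℤ)` computes degrees**: for `p ≠ 0` and a base point
`a`, a homomorphism `w : H₁(ℝ/pℤ; ℤ) → ℤ` (multiplicative notation) with `w (h g) = deg g` for
every `g ∈ π₁(ℝ/pℤ, a)` — the inverse of the Hurewicz isomorphism (Hatcher Thm. 2A.1, injective as
`π₁` is commutative) followed by `π₁(ℝ/pℤ, a) ≅ ℤ` (Hatcher Thm. 1.7).
[cite: HatcherAT2002, Thm. 1.7 and Thm. 2A.1] -/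
theorem exists_windingHom_addCircle_eq (hp : p ≠ 0) (a : AddCircle p) :
    ∃ w : Multiplicative (singularHomology ℤ ℤ (AddCircle p) 1) →* Multiplicative ℤ,
      ∀ g, w (hurewiczOne ℤ ℤ (1 : ℤ) a g) = fundamentalGroupAddCircleEquiv hp a g := by
  haveI : Fact (0 < |p|) := ⟨abs_pos.2 hp⟩
  set eZ := fundamentalGroupAddCircleEquiv hp a with heZ
  set hur := hurewiczOne ℤ ℤ (1 : ℤ) a with hhur
  have hinj : Function.Injective hur := by
    rw [← MonoidHom.ker_eq_bot_iff, hhur, HurewiczProof.ker_hurewiczOne]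
    exact commutator_eq_bot_of_mulEquiv_int eZ
  have hsurj : Function.Surjective hur := HurewiczProof.hurewiczOne_surjective a
  set eH := MulEquiv.ofBijective hur ⟨hinj, hsurj⟩ with heH
  refine ⟨eZ.toMonoidHom.comp eH.symm.toMonoidHom, fun g => ?_⟩
  rw [MonoidHom.comp_apply, MulEquiv.coe_toMonoidHom, MulEquiv.coe_toMonoidHom]
  have : eH.symm (hur g) = g := by rw [MulEquiv.symm_apply_eq]; rfl
  rw [this]

end Circle

/-! ### The Mayer–Vietoris map `Φ = (i_U, -i_V)` is an isomorphism in degree one -/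

section MayerVietoris

universe u

variable {S : Type u} [TopologicalSpace S]

/-- **Mayer–Vietoris in degree one with vanishing `H₁(S)`, `H₂(S)`**: if `interior U ∪ interior V = S`
and `H₁(S; ℤ) = H₂(S; ℤ) = 0` then `Φ = (i_U, -i_V) : H₁(U ∩ V; ℤ) ⟶ H₁(U; ℤ) ⊞ H₁(V; ℤ)` is an
isomorphism (`δ = 0` and `ψ = 0` in the tree's exact sequence `mayerVietoris.exact₁/₃_holds`;
Hatcher 2002, §2.2 p. 149). [cite: HatcherAT2002, §2.2 p. 149] -/
theorem isIso_mayerVietoris_phi_one (U V : Set S) (hUV : interior U ∪ interior V = univ)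
    (hS1 : IsZero (singularHomology ℤ ℤ S 1)) (hS2 : IsZero (singularHomology ℤ ℤ S 2)) :
    IsIso (mayerVietoris.φ ℤ ℤ U V 1) := by
  have hexc := relativeSingularHomology.isIso_map_of_interior_union_interior_holds ℤ ℤ S
  have hδ : mayerVietoris.δ ℤ ℤ U V hexc hUV 1 = 0 := hS2.eq_of_src _ _
  haveI hmono : Mono (mayerVietoris.φ ℤ ℤ U V 1) :=
    (mayerVietoris.exact₃_holds ℤ ℤ U V hexc hUV 1).mono_g hδ
  have hψ : mayerVietoris.ψ ℤ ℤ U V 1 = 0 := hS1.eq_of_tgt _ _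
  haveI hepi : Epi (mayerVietoris.φ ℤ ℤ U V 1) :=
    (mayerVietoris.exact₁_holds ℤ ℤ U V hUV 1).epi_f hψ
  exact isIso_of_mono_of_epi _

end MayerVietoris

/-! ### Loops winding `k` times around the core -/

namespace FramedTubularEmbedding

variable {n : ℕ} {M : Type} [TopologicalSpace M] [ChartedSpace (𝔼 n) M]
  (E : FramedTubularEmbedding n 2 M)

/-- The circle point after `k` full turns is the start. [folklore] -/
theorem circlePoint_two_pi_mul_int (k : ℤ) : circlePoint (2 * Real.pi * k * 1) = circlePoint 0 := by
  rw [mul_one, show 2 * Real.pi * (k : ℝ) = 0 + k * (2 * Real.pi) by ring]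
  exact periodic_circlePoint.int_mul k 0

/-- **The plane loop winding `k` times**: `t ↦ (cos 2πkt, sin 2πkt)` in `ℝ²`, based at
`e₀ = (1, 0)`. [folklore] -/
def planeLoop (k : ℤ) : Path (((circlePoint 0 : 𝕊 1) : 𝔼 2)) (((circlePoint 0 : 𝕊 1) : 𝔼 2)) where
  toFun t := ((circlePoint (2 * Real.pi * k * t) : 𝕊 1) : 𝔼 2)
  continuous_toFun := continuous_subtype_val.comp
    (continuous_circlePoint.comp (continuous_const.mul continuous_subtype_val))
  source' := by simp
  target' := by
    show ((circlePoint (2 * Real.pi * k * 1) : 𝕊 1) : 𝔼 2) = _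
    rw [circlePoint_two_pi_mul_int]

/-- Values of the plane loop. [folklore] -/
@[simp] theorem planeLoop_apply (k : ℤ) (t : unitInterval) :
    planeLoop k t = ((circlePoint (2 * Real.pi * k * t) : 𝕊 1) : 𝔼 2) := rfl

/-- **The slice of the tube over `x₀`**: `w ↦ tube (x₀, w)`, into the open tube. [folklore] -/
def sliceU (x₀ : M) : C(𝔼 2, ↥(range E.tube)) :=
  ⟨fun w => ⟨E.tube (x₀, w), mem_range_self _⟩,
    (E.continuous_tube.comp (continuous_const.prodMk continuous_id)).subtype_mk _⟩

variable [CompactSpace M]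

/-- **The `k`-fold meridian** `μᵏ : t ↦ tube (x₀, (cos 2πkt, sin 2πkt))`, a loop at `p₀` in the
complement of the core winding `k` times around it (`k = 1`: `meridian`). [cite: Kirby1989, Ch. VIII, proof of Thm. 3 (p. 45)] -/
def meridianPow (x₀ : M) (k : ℤ) : Path (E.basePt' x₀) (E.basePt' x₀) where
  toFun t := ⟨E.tube (x₀, planeLoop k t), E.tube_not_mem_range_emb x₀ (ne_zero_of_mem_unit_sphere _)⟩
  continuous_toFun := (E.continuous_tube.comp (continuous_const.prodMk (planeLoop k).continuous)).subtype_mk _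
  source' := by
    apply Subtype.ext
    show E.tube (x₀, planeLoop k 0) = E.basePt x₀
    rw [(planeLoop k).source]; rfl
  target' := by
    apply Subtype.ext
    show E.tube (x₀, planeLoop k 1) = E.basePt x₀
    rw [(planeLoop k).target]; rfl

/-- Values of the `k`-fold meridian. [folklore] -/
theorem meridianPow_apply_coe (x₀ : M) (k : ℤ) (t : unitInterval) :
    ((E.meridianPow x₀ k t : E.embCompl) : 𝕊 (n + 2)) =
      E.tube (x₀, ((circlePoint (2 * Real.pi * k * t) : 𝕊 1) : 𝔼 2)) := rfl

/-- The `1`-fold meridian is the meridian. [folklore] -/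
theorem meridianPow_one (x₀ : M) : E.meridianPow x₀ 1 = E.meridian x₀ := by
  refine Path.ext (funext fun t => Subtype.ext ?_)
  rw [meridianPow_apply_coe, meridian_apply_coe, Int.cast_one, mul_one]

/-- The `k`-fold meridian as a loop in the punctured tube. [folklore] -/
def meridianPowInter (x₀ : M) (k : ℤ) : Path (E.basePtInter x₀) (E.basePtInter x₀) where
  toFun t := ⟨E.tube (x₀, planeLoop k t), mem_range_self _,
    E.tube_not_mem_range_emb x₀ (ne_zero_of_mem_unit_sphere _)⟩
  continuous_toFun := (E.continuous_tube.comp (continuous_const.prodMk (planeLoop k).continuous)).subtype_mk _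
  source' := by
    apply Subtype.ext
    show E.tube (x₀, planeLoop k 0) = E.basePt x₀
    rw [(planeLoop k).source]; rfl
  target' := by
    apply Subtype.ext
    show E.tube (x₀, planeLoop k 1) = E.basePt x₀
    rw [(planeLoop k).target]; rfl

/-- Under the inclusion in the complement the `k`-fold meridian of the punctured tube is `μᵏ`.
[folklore] -/
theorem meridianPowInter_map_inclInter (x₀ : M) (k : ℤ) :
    (E.meridianPowInter x₀ k).map E.inclInter.continuous = E.meridianPow x₀ k := by
  ext t
  rfl

/-- The same, for the inclusion written as the tree's `subsetInclusion` into the complement as a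
subset of the sphere (the form in which the Mayer–Vietoris maps are stated). [folklore] -/
theorem meridianPowInter_map_right (x₀ : M) (k : ℤ) :
    (E.meridianPowInter x₀ k).map (subsetInclusion
      (inter_subset_right : range E.tube ∩ (range E.emb)ᶜ ⊆ (range E.emb)ᶜ)).continuous =
      (E.meridianPow x₀ k : Path (E.basePt' x₀) (E.basePt' x₀)) := by
  ext t
  rfl

omit [CompactSpace M] in
/-- Under the inclusion in the open tube the `k`-fold meridian of the punctured tube is the image of
the plane loop under the slice over `x₀`. [folklore] -/
theorem meridianPowInter_map_left (x₀ : M) (k : ℤ) :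
    (E.meridianPowInter x₀ k).map (subsetInclusion
      (inter_subset_left : range E.tube ∩ (range E.emb)ᶜ ⊆ range E.tube)).continuous =
      (planeLoop k).map (E.sliceU x₀).continuous := by
  ext t
  rfl

omit [CompactSpace M] in
/-- **The `k`-fold meridian is null-homotopic in the open tube** (it bounds the normal disc: the
plane loop is null-homotopic in `ℝ²`). [folklore] -/
theorem map_left_meridianPowInter_eq_one (x₀ : M) (k : ℤ) :
    FundamentalGroup.map (subsetInclusion
      (inter_subset_left : range E.tube ∩ (range E.emb)ᶜ ⊆ range E.tube)) (E.basePtInter x₀)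
        (FundamentalGroup.fromPath ⟦E.meridianPowInter x₀ k⟧ₚ) = 1 := by
  have hq := Path.Homotopic.Quotient.eq.2
    ((SimplyConnectedSpace.paths_homotopic (planeLoop k) (Path.refl _)).map (E.sliceU x₀))
  change FundamentalGroup.fromPath ⟦(E.meridianPowInter x₀ k).map (subsetInclusion
    (inter_subset_left : range E.tube ∩ (range E.emb)ᶜ ⊆ range E.tube)).continuous⟧ₚ = 1
  rw [meridianPowInter_map_left]
  exact (congrArg FundamentalGroup.fromPath hq).trans rfl

omit [CompactSpace M] in
/-- The angle of the `k`-fold meridian is the linear loop `t ↦ 2πkt` of `ℝ/2πℤ`. [folklore] -/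
theorem planeAngle_meridianPowInter (x₀ : M) (k : ℤ) (t : unitInterval) :
    CodimTwo.planeAngle (E.fib (E.meridianPowInter x₀ k t).1) =
      linLoop (2 * Real.pi) (0 : AddCircle (2 * Real.pi)) k t := by
  show CodimTwo.planeAngle (E.fib (E.tube (x₀, ((circlePoint (2 * Real.pi * k * t) : 𝕊 1) : 𝔼 2)))) = _
  rw [E.fib_apply, CodimTwo.planeAngle_circlePoint, linLoop_apply, zero_add]
  congr 1
  ring

/-! ### The linking homomorphism for a connected core -/
set_option maxHeartbeats 400000 in -- buildfix (bf3-g27): 160k/180k FAIL, 200k PASS at accept time; line-neutral budget line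
/-- **The linking homomorphism with a connected core** (Kirby 1989, proof of VIII Thm. 3: the
class `α ∈ H¹(Q − N; ℤ) = Hom(π₁, ℤ)` "dual to the meridian" of `N`, for `Q = Sⁿ⁺²`, `n ≥ 1`, and a
connected nonempty compact core `N = M` with a framed tubular neighbourhood): there is a
homomorphism `φ : π₁(Sⁿ⁺² ∖ M, p₀) → ℤ` with `φ [μᵏ] = k` for every `k ∈ ℤ`, `μᵏ` the `k`-fold
meridian.  Proof: the Mayer–Vietoris isomorphism `Φ = (i_U, -i_X) : H₁(P) ≅ H₁(U) ⊕ H₁(X)`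
(`isIso_mayerVietoris_phi_one`, `H₁(Sⁿ⁺²) = H₂(Sⁿ⁺²) = 0`), the vanishing `i_U h(μᵏ) = 0` (`μᵏ`
bounds the normal disc in the tube `U`), the fibre angle `P → ℝ/2πℤ`, the winding functional
(`exists_windingHom_addCircle_eq`), the naturality of the Hurewicz map (`hurewiczOne_map`) and the
degree of the linear loop (`fundamentalGroupAddCircleEquiv_linLoop`).
[cite: Kirby1989, Ch. VIII, proof of Thm. 3 (p. 45)] -/
theorem exists_linkingHom_meridianPow [ConnectedSpace M] [Nonempty M] (hn : 1 ≤ n) (x₀ : M) :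
    ∃ φ : FundamentalGroup E.embCompl (E.basePt' x₀) →* Multiplicative ℤ,
      ∀ k : ℤ, φ (FundamentalGroup.fromPath ⟦E.meridianPow x₀ k⟧ₚ) = Multiplicative.ofAdd k := by
  -- the two open pieces of the sphere and their intersection
  set U : Set (𝕊 (n + 2)) := range E.tube with hU
  set V : Set (𝕊 (n + 2)) := (range E.emb)ᶜ with hV
  have hUo : IsOpen U := E.isOpen_range
  have hVo : IsOpen V := E.isClosed_range_emb.isOpen_compl
  have hUV : interior U ∪ interior V = univ := by
    rw [hUo.interior_eq, hVo.interior_eq]; exact E.range_tube_union_compl_range_emb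
  -- `H₁(Sⁿ⁺²) = H₂(Sⁿ⁺²) = 0`
  have hS1 : IsZero (singularHomology ℤ ℤ (𝕊 (n + 2)) 1) :=
    isZero_singularHomology_sphere_holds ℤ ℤ one_ne_zero (by omega)
  have hS2 : IsZero (singularHomology ℤ ℤ (𝕊 (n + 2)) 2) :=
    isZero_singularHomology_sphere_holds ℤ ℤ two_ne_zero (by omega)
  -- the Mayer–Vietoris isomorphism `Φ : H₁(U ∩ V) ≅ H₁(U) ⊞ H₁(V)`
  haveI hiso : IsIso (mayerVietoris.φ ℤ ℤ U V 1) := isIso_mayerVietoris_phi_one U V hUV hS1 hS2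
  set eΦ := (asIso (mayerVietoris.φ ℤ ℤ U V 1)).toLinearEquiv with heΦ
  have heΦ_apply : ∀ y, eΦ y = mayerVietoris.φ ℤ ℤ U V 1 y := fun y => rfl
  set jU : C(↥(U ∩ V), ↥U) := subsetInclusion (inter_subset_left : U ∩ V ⊆ U) with hjU
  set i : C(↥(U ∩ V), ↥V) := subsetInclusion (inter_subset_right : U ∩ V ⊆ V) with hi
  -- the two components of `Φ y`
  have hfst : ∀ y, (biprod.fst : _ ⟶ singularHomology ℤ ℤ U 1) (eΦ y) =
      singularHomology.map ℤ ℤ jU 1 y := fun y => by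
    rw [heΦ_apply]
    exact biprod_fst_lift_apply _ _ y
  have hsnd : ∀ y, (biprod.snd : _ ⟶ singularHomology ℤ ℤ V 1) (eΦ y) =
      -(singularHomology.map ℤ ℤ i 1 y) := fun y => by
    rw [heΦ_apply]
    exact biprod_snd_lift_apply _ _ y
  -- the fibre angle on the punctured tube `U ∩ V`
  have hmemP : ∀ q : ↥(U ∩ V), E.fib q.1 ≠ 0 := by
    rintro ⟨q, hqU, hqV⟩ h0
    obtain ⟨⟨x, w⟩, rfl⟩ := hqU
    rw [E.fib_apply] at h0
    exact hqV ((E.tube_mem_range_emb_iff x w).2 h0)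
  have hang_cont : Continuous fun q : ↥(U ∩ V) => CodimTwo.planeAngle (E.fib q.1) := by
    rw [continuous_iff_continuousAt]
    rintro ⟨q, hqU, hqV⟩
    have h1 : ContinuousAt E.fib q :=
      (E.contMDiffOn_fib.continuousOn.continuousWithinAt hqU).continuousAt (hUo.mem_nhds hqU)
    exact ((CodimTwo.continuousAt_planeAngle (hmemP ⟨q, hqU, hqV⟩)).comp h1).comp
      continuous_subtype_val.continuousAt
  set ang : C(↥(U ∩ V), AddCircle (2 * Real.pi)) :=
    ⟨fun q => CodimTwo.planeAngle (E.fib q.1), hang_cont⟩ with hang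
  -- the angle of the base point
  set a₀ : AddCircle (2 * Real.pi) := ang (E.basePtInter x₀) with ha₀
  have ha₀0 : a₀ = 0 := by
    show CodimTwo.planeAngle (E.fib (E.basePt x₀)) = 0
    rw [basePt, E.fib_apply, CodimTwo.planeAngle_circlePoint]
    simp
  -- the winding functional on `H₁(ℝ/2πℤ)` at `a₀`
  have h2pi : (2 * Real.pi) ≠ 0 := by positivity
  obtain ⟨w, hw⟩ := exists_windingHom_addCircle_eq h2pi a₀
  -- assemble `φ = (w ∘ ang_* ∘ Φ⁻¹ ∘ inr)⁻¹ ∘ h_X` (opaque homomorphisms with their equations)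
  obtain ⟨eInv, heInv⟩ : ∃ f : Multiplicative (↑(singularHomology ℤ ℤ U 1 ⊞ singularHomology ℤ ℤ V 1)) →*
      Multiplicative (singularHomology ℤ ℤ ↥(U ∩ V) 1),
      ∀ z, f (Multiplicative.ofAdd z) = Multiplicative.ofAdd (eΦ.symm z) :=
    ⟨AddMonoidHom.toMultiplicative eΦ.symm.toLinearMap.toAddMonoidHom, fun _ => rfl⟩
  obtain ⟨inrM, hinrM⟩ : ∃ f : Multiplicative (singularHomology ℤ ℤ V 1) →*
      Multiplicative (↑(singularHomology ℤ ℤ U 1 ⊞ singularHomology ℤ ℤ V 1)),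
      ∀ z, f (Multiplicative.ofAdd z) = Multiplicative.ofAdd
        ((biprod.inr : singularHomology ℤ ℤ V 1 ⟶ _) z) :=
    ⟨AddMonoidHom.toMultiplicative
      (biprod.inr : singularHomology ℤ ℤ V 1 ⟶ _).hom.toAddMonoidHom, fun _ => rfl⟩
  obtain ⟨ang1, hang1⟩ : ∃ f : Multiplicative (singularHomology ℤ ℤ ↥(U ∩ V) 1) →*
      Multiplicative (singularHomology ℤ ℤ (AddCircle (2 * Real.pi)) 1),
      ∀ z, f (Multiplicative.ofAdd z) = Multiplicative.ofAdd (singularHomology.map ℤ ℤ ang 1 z) :=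
    ⟨AddMonoidHom.toMultiplicative (singularHomology.map ℤ ℤ ang 1).hom.toAddMonoidHom,
      fun _ => rfl⟩
  obtain ⟨ψ, hψ⟩ : ∃ f : Multiplicative (singularHomology ℤ ℤ V 1) →* Multiplicative ℤ,
      ∀ z, f z = (w (ang1 (eInv (inrM z))))⁻¹ :=
    ⟨(w.comp (ang1.comp (eInv.comp inrM)))⁻¹, fun _ => rfl⟩
  obtain ⟨φ, hφ⟩ : ∃ f : FundamentalGroup (↥V) (i (E.basePtInter x₀)) →* Multiplicative ℤ,
      ∀ g, f g = ψ (hurewiczOne ℤ ℤ (1 : ℤ) (i (E.basePtInter x₀)) g) :=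
    ⟨ψ.comp (hurewiczOne ℤ ℤ (1 : ℤ) (i (E.basePtInter x₀))), fun _ => rfl⟩
  -- evaluate on `μᵏ`
  have key : ∀ k : ℤ, φ (FundamentalGroup.map i (E.basePtInter x₀)
      (FundamentalGroup.fromPath ⟦E.meridianPowInter x₀ k⟧ₚ)) = Multiplicative.ofAdd k := by
    intro k
    set g₀ := FundamentalGroup.fromPath ⟦E.meridianPowInter x₀ k⟧ₚ with hg₀
    set y := Multiplicative.toAdd (hurewiczOne ℤ ℤ (1 : ℤ) (E.basePtInter x₀) g₀) with hy
    -- naturality of the Hurewicz map along `i` and along `jU`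
    have hnat_i : hurewiczOne ℤ ℤ (1 : ℤ) (i (E.basePtInter x₀))
        (FundamentalGroup.map i (E.basePtInter x₀) g₀) =
        Multiplicative.ofAdd (singularHomology.map ℤ ℤ i 1 y) :=
      hurewiczOne_map (R := ℤ) ℤ (1 : ℤ) i (E.basePtInter x₀) g₀
    have hjU0 : singularHomology.map ℤ ℤ jU 1 y = 0 := by
      have h := hurewiczOne_map (R := ℤ) ℤ (1 : ℤ) jU (E.basePtInter x₀) g₀
      rw [E.map_left_meridianPowInter_eq_one x₀ k, map_one] at h
      have h' := congrArg Multiplicative.toAdd h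
      rw [toAdd_one, toAdd_ofAdd] at h'
      exact h'.symm
    -- `Φ y = inr (-i_* y)`, hence `Φ⁻¹ (inr (i_* y)) = -y`
    have hΦy : eΦ y = (biprod.inr : singularHomology ℤ ℤ V 1 ⟶ _)
        (-(singularHomology.map ℤ ℤ i 1 y)) := by
      apply biprod_apply_ext
      · rw [hfst, hjU0, ← ModuleCat.comp_apply, biprod.inr_fst]
        exact (LinearMap.zero_apply (M := ↑(singularHomology ℤ ℤ V 1))
          (M₂ := ↑(singularHomology ℤ ℤ U 1)) _).symm
      · rw [hsnd, ← ModuleCat.comp_apply, biprod.inr_snd, ModuleCat.id_apply]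
    have hinv : eΦ.symm ((biprod.inr : singularHomology ℤ ℤ V 1 ⟶ _)
        (singularHomology.map ℤ ℤ i 1 y)) = -y := by
      rw [LinearEquiv.symm_apply_eq, map_neg, hΦy, map_neg, neg_neg]
    -- naturality along the angle map and the degree of the linear loop
    have hangmap : FundamentalGroup.map ang (E.basePtInter x₀) g₀ =
        FundamentalGroup.fromPath ⟦linLoop (2 * Real.pi) a₀ k⟧ₚ := by
      have hpath : (E.meridianPowInter x₀ k).map ang.continuous = linLoop (2 * Real.pi) a₀ k := by
        ext t
        show CodimTwo.planeAngle (E.fib (E.meridianPowInter x₀ k t).1) =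
          linLoop (2 * Real.pi) a₀ k t
        rw [E.planeAngle_meridianPowInter, ha₀0]
      rw [← hpath]
      rfl
    have hwy : w (Multiplicative.ofAdd (singularHomology.map ℤ ℤ ang 1 y)) =
        Multiplicative.ofAdd k := by
      have h := hurewiczOne_map (R := ℤ) ℤ (1 : ℤ) ang (E.basePtInter x₀) g₀
      rw [← h, hw, hangmap]
      exact fundamentalGroupAddCircleEquiv_linLoop h2pi a₀ k
    -- assemble
    rw [hφ, hnat_i, hψ, hinrM, heInv, hinv, hang1, map_neg, ofAdd_neg, map_inv, inv_inv, hwy]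
  refine ⟨φ, fun k => ?_⟩
  have hmer : FundamentalGroup.fromPath ⟦E.meridianPow x₀ k⟧ₚ =
      FundamentalGroup.map i (E.basePtInter x₀)
        (FundamentalGroup.fromPath ⟦E.meridianPowInter x₀ k⟧ₚ) := by
    rw [← E.meridianPowInter_map_right x₀ k]; rfl
  rw [hmer]
  exact key k

/-- **The linking homomorphism with a connected core, value `1` on the meridian** (the case
`k = 1` of `exists_linkingHom_meridianPow`, in the form consumed by `CodimTwoCircleMap.lean`).
[cite: Kirby1989, Ch. VIII, proof of Thm. 3 (p. 45)] -/
theorem exists_linkingHom_of_connectedSpace [ConnectedSpace M] [Nonempty M] (hn : 1 ≤ n) (x₀ : M) :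
    ∃ φ : FundamentalGroup E.embCompl (E.basePt' x₀) →* Multiplicative ℤ,
      φ (FundamentalGroup.fromPath ⟦E.meridian x₀⟧ₚ) = Multiplicative.ofAdd 1 ∧
      ∀ k : ℤ, φ (FundamentalGroup.fromPath ⟦E.meridianPow x₀ k⟧ₚ) = Multiplicative.ofAdd k := by
  obtain ⟨φ, hφ⟩ := E.exists_linkingHom_meridianPow hn x₀
  refine ⟨φ, ?_, hφ⟩
  rw [← meridianPow_one]
  exact hφ 1

end FramedTubularEmbedding

end Literature.Topology.FourManifolds
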